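import Summits.Parity.GeneralizedHardyLittlewood.Theorems.PrimeLevelFamEdgeMomentsBeyondDiagonalDiagDecorBilinear
import Summits.Parity.GeneralizedHardyLittlewood.Theorems.PrimeLevelFamEdgeMomentsBeyondDiagonalDiagDecorCollapse
import HarnessLib

/-!
# Route `PrimeLevelFamEdge`, crux K_A `MomentsBeyondDiagonal` (stmt-Parity-20007), line «petersson_layers» v4, stub `stub_diag`:
# **the PRODUCT-MONOMIAL master step of the per-order targets: a `log g`-free monomial `t₁(k₁)·t₂(k₂)` of the decorated
# Selberg form evaluates to `ζ(2)²·(∫₀¹R₁R₂)·log M/log^{s₁+s₂}M + O(log^{−(s₁+s₂)}M)` as soon as the two decorated profile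
# coordinates are `E_n R_i(u_n)/log^{s_i}M + O(D(n)(1+κ(n))/log^{s_i+1}M)`**

Census R3(ii), ANALYTIC HALF — assembly of the engines of this line (`…DiagDecorProfileCoord`, `…DiagDecorCollapse`,
`…DiagDecorBilinear`). In the decorated Selberg coordinates of `…DiagOrderSelberg` (p821962),
`Sel(W) = Σ_{c≤N}Σ_{g≤N/c} μ(g)·c·Σ_{k₁,k₂≤N/(cg)} y′(cgk₁)y′(cgk₂)·Σ_{d∣k₁}Σ_{e∣k₂} W(…)`,
`y′(m) = μ(m)ψ(m)⁻¹P(log(M/m)/log M)/m`, `N = ⌊M⌋`. After the multinomial expansion of the order-`(i,j)` weight, each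
monomial WITHOUT `log g` has `Σ_{d∣k₁}Σ_{e∣k₂}(…) = t₁(k₁)·t₂(k₂)` (products of `τ_{α,β}`'s and powers of `log k`). For these:

* `mollifierWeight_mul_eq` — **the decorated weight bridge** `y′(nk) = W(n)·W(k)[(k,n)=1]·Σ_c P_c logᶜ((M/n)/k)/logᶜM`
  (`W = μ/(id·ψ)` multiplicative, zero off the squarefree numbers; the `τ`-free form of `…DiagProfile.selA_profile`);
* `selbergInner_eq_W_sq_mul` — the inner double `k`-sum FACTORS: `Σ_{k₁,k₂≤N/n} y′(nk₁)y′(nk₂)t₁(k₁)t₂(k₂) = W(n)²·𝒮₁(n)·𝒮₂(n)`,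
  `𝒮_i(n) = Σ_c P_c·(Σ_{k≤M/n} W(k)[(k,n)=1]·t_i(k)·logᶜ((M/n)/k))/logᶜM` (the decorated profile coordinates);
* `abs_selbergMonomial_sub_le` — **master step**: if `|𝒮_i(n) − E_n R_i(u_n)/log^{s_i}M| ≤ C_i D(n)(1+κ(n))/log^{s_i+1}M`
  (`M ≥ 3`, `1 ≤ n ≤ M`; supplied by `…DiagDecorProfileCoord`: `t = τ_{1,1} ↦ (R,s) = (P,0)`, `τ_{1,0} ↦ (−P′,1)`, `τ_{2,0} ↦ (0,0)`,
  and by `…DiagProfileCoord` for `t = τ`: `(P″,2)`), then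
  `|Σ_{c≤⌊M⌋}Σ_{g≤⌊M⌋/c} μ(g)c·Σ_{k₁,k₂≤⌊M⌋/(cg)} y′(cgk₁)y′(cgk₂)t₁(k₁)t₂(k₂) − (π²/6)²(∫₀¹R₁R₂)·log M/log^{s₁+s₂}M| ≤ C/log^{s₁+s₂}M`
  (`selbergCollapse_zero` + `abs_bilinearHarmonic_sub_le`).

E.g. the monomial `τ_{1,1}(k₁)τ_{1,1}(k₂)` of the order-`(1,1)` weight gives `ζ(2)²∫₀¹P²·log M` at `M = q̂^{Δ′}`. Monomials with
`(log g)^r`, `r ≥ 1`, are one logarithm smaller (`…DiagDecorCollapseBounds`). Def-free; theorems only. Helper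
`--supports stmt-Parity-20007`; closes nothing; K_A, K_B and the Parity summit are NOT proved; nothing about Landau–Siegel zeros.

## References
* E. Kowalski, P. Michel, J. VanderKam, J. reine angew. Math. 526 (2000), (23)–(28) pp. 13–15 and Prop. 5.1 p. 18.
  [cite: KowalskiMichelVanderKam2000, (23)–(28) — derivation (monomials of the diagonal main term in real variables)]
-/

noncomputable section

open scoped Real ArithmeticFunction.Moebius
open Finset ArithmeticFunction Polynomial MeasureTheory intervalIntegral

namespace Summit.Parity.GeneralizedHardyLittlewood.Theorems.MomentsBeyondDiagonal.DiagKernel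

open Literature.NumberTheory.LFunctions Literature.NumberTheory.LFunctions.KMV2000
open MollifierMainTerm (W)
open SelbergCoord (kappa)
open Summit.Parity.GeneralizedHardyLittlewood.Theorems.BeyondDiagonalBeatsQuarter.KernelFormXSq
  (mainConst divWeight W_apply'' W_eq_zero_of_not_squarefree isMultiplicative_W')

/-! ### The decorated weight bridge -/

/-- **The decorated mollifier weight bridge**: for `n, k ≥ 1`,
`μ(nk)ψ(nk)⁻¹P(log(M/(nk))/log M)/(nk) = W(n)·W(k)[(k,n)=1]·Σ_c P_c logᶜ((M/n)/k)/logᶜM`.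
[cite: KowalskiMichelVanderKam2000, (23) — derivation (Selberg coordinates of the mollifier)] -/
theorem mollifierWeight_mul_eq (P : ℝ[X]) (M : ℝ) {n k : ℕ} (hn : n ≠ 0) (hk : k ≠ 0) :
    ((μ (n * k) : ℝ) * ((psi (n * k))⁻¹ * P.eval (Real.log (M / ((n * k : ℕ) : ℝ)) / Real.log M))) /
        ((n * k : ℕ) : ℝ) =
      W n * ((if k.Coprime n then W k else 0) *
        ∑ c ∈ Finset.range (P.natDegree + 1), P.coeff c * Real.log (M / n / k) ^ c / Real.log M ^ c) := by
  have hnk : n * k ≠ 0 := mul_ne_zero hn hk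
  have hnkR : ((n * k : ℕ) : ℝ) ≠ 0 := by exact_mod_cast hnk
  have hW : ((μ (n * k) : ℝ) * ((psi (n * k))⁻¹ * P.eval (Real.log (M / ((n * k : ℕ) : ℝ)) / Real.log M))) /
      ((n * k : ℕ) : ℝ) = W (n * k) * P.eval (Real.log (M / ((n * k : ℕ) : ℝ)) / Real.log M) := by
    rw [W_apply'' hnk]
    field_simp
  have hlog : Real.log (M / ((n * k : ℕ) : ℝ)) = Real.log (M / n / k) := by
    push_cast; rw [div_div]
  have heval : P.eval (Real.log (M / n / k) / Real.log M) =
      ∑ c ∈ Finset.range (P.natDegree + 1), P.coeff c * Real.log (M / n / k) ^ c / Real.log M ^ c := by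
    rw [Polynomial.eval_eq_sum_range]
    refine Finset.sum_congr rfl fun c _ ↦ ?_
    rw [div_pow, mul_div_assoc]
  rw [hW, hlog, heval]
  by_cases hc : k.Coprime n
  · rw [if_pos hc, isMultiplicative_W'.map_mul_of_coprime hc.symm, mul_assoc]
  · rw [if_neg hc]
    have hns : ¬ Squarefree (n * k) := fun h ↦ hc (Nat.coprime_of_squarefree_mul h).symm
    rw [W_eq_zero_of_not_squarefree hns]
    ring

/-- The one-variable `k`-sum in decorated form: `Σ_{k≤⌊M⌋/n} y′(nk)·t(k) = W(n)·𝒮_t(n)`,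
`𝒮_t(n) = Σ_c P_c (Σ_{k≤M/n} W(k)[(k,n)=1]·t(k)·logᶜ((M/n)/k))/logᶜM`. [cite: KowalskiMichelVanderKam2000, (23) — derivation] -/
theorem sum_mollifierWeight_mul_eq (P : ℝ[X]) (M : ℝ) {n : ℕ} (hn : n ≠ 0) (t : ℕ → ℝ) :
    ∑ k ∈ Icc 1 (⌊M⌋₊ / n), ((μ (n * k) : ℝ) * ((psi (n * k))⁻¹ *
        P.eval (Real.log (M / ((n * k : ℕ) : ℝ)) / Real.log M))) / ((n * k : ℕ) : ℝ) * t k =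
      W n * ∑ c ∈ Finset.range (P.natDegree + 1), P.coeff c *
        ((∑ k ∈ Icc 1 ⌊M / n⌋₊, (if k.Coprime n then W k else 0) * t k * Real.log (M / n / k) ^ c) /
          Real.log M ^ c) := by
  rw [← Nat.floor_div_natCast]
  have hterm : ∀ k ∈ Icc 1 ⌊M / (n : ℝ)⌋₊, ((μ (n * k) : ℝ) * ((psi (n * k))⁻¹ *
      P.eval (Real.log (M / ((n * k : ℕ) : ℝ)) / Real.log M))) / ((n * k : ℕ) : ℝ) * t k =
      W n * ∑ c ∈ Finset.range (P.natDegree + 1), P.coeff c *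
        (((if k.Coprime n then W k else 0) * t k * Real.log (M / n / k) ^ c) / Real.log M ^ c) := by
    intro k hk
    have hk0 : k ≠ 0 := by have := (Finset.mem_Icc.1 hk).1; omega
    rw [mollifierWeight_mul_eq P M hn hk0, mul_assoc]
    congr 1
    rw [Finset.mul_sum, Finset.sum_mul]
    exact Finset.sum_congr rfl fun c _ ↦ by ring
  rw [Finset.sum_congr rfl hterm, ← Finset.mul_sum, Finset.sum_comm]
  congr 1
  refine Finset.sum_congr rfl fun c _ ↦ ?_
  simp only [Finset.sum_div, Finset.mul_sum]

/-- **The inner double `k`-sum factors**: `Σ_{k₁,k₂≤⌊M⌋/n} y′(nk₁)y′(nk₂)·t₁(k₁)t₂(k₂) = W(n)²·𝒮₁(n)·𝒮₂(n)`.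
[cite: KowalskiMichelVanderKam2000, (23) — derivation] -/
theorem selbergInner_eq_W_sq_mul (P : ℝ[X]) (M : ℝ) {n : ℕ} (hn : n ≠ 0) (t₁ t₂ : ℕ → ℝ) :
    ∑ k₁ ∈ Icc 1 (⌊M⌋₊ / n), ∑ k₂ ∈ Icc 1 (⌊M⌋₊ / n),
        ((μ (n * k₁) : ℝ) * ((psi (n * k₁))⁻¹ *
            P.eval (Real.log (M / ((n * k₁ : ℕ) : ℝ)) / Real.log M))) / ((n * k₁ : ℕ) : ℝ) *
          (((μ (n * k₂) : ℝ) * ((psi (n * k₂))⁻¹ *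
            P.eval (Real.log (M / ((n * k₂ : ℕ) : ℝ)) / Real.log M))) / ((n * k₂ : ℕ) : ℝ)) *
          (t₁ k₁ * t₂ k₂) =
      W n ^ 2 *
        ((∑ c ∈ Finset.range (P.natDegree + 1), P.coeff c *
          ((∑ k ∈ Icc 1 ⌊M / n⌋₊, (if k.Coprime n then W k else 0) * t₁ k * Real.log (M / n / k) ^ c) /
            Real.log M ^ c)) *
        (∑ c ∈ Finset.range (P.natDegree + 1), P.coeff c *
          ((∑ k ∈ Icc 1 ⌊M / n⌋₊, (if k.Coprime n then W k else 0) * t₂ k * Real.log (M / n / k) ^ c) /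
            Real.log M ^ c))) := by
  have h1 := sum_mollifierWeight_mul_eq P M hn t₁
  have h2 := sum_mollifierWeight_mul_eq P M hn t₂
  have hre : ∑ k₁ ∈ Icc 1 (⌊M⌋₊ / n), ∑ k₂ ∈ Icc 1 (⌊M⌋₊ / n),
      ((μ (n * k₁) : ℝ) * ((psi (n * k₁))⁻¹ *
          P.eval (Real.log (M / ((n * k₁ : ℕ) : ℝ)) / Real.log M))) / ((n * k₁ : ℕ) : ℝ) *
        (((μ (n * k₂) : ℝ) * ((psi (n * k₂))⁻¹ *
          P.eval (Real.log (M / ((n * k₂ : ℕ) : ℝ)) / Real.log M))) / ((n * k₂ : ℕ) : ℝ)) *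
        (t₁ k₁ * t₂ k₂) =
      (∑ k₁ ∈ Icc 1 (⌊M⌋₊ / n), ((μ (n * k₁) : ℝ) * ((psi (n * k₁))⁻¹ *
          P.eval (Real.log (M / ((n * k₁ : ℕ) : ℝ)) / Real.log M))) / ((n * k₁ : ℕ) : ℝ) * t₁ k₁) *
      (∑ k₂ ∈ Icc 1 (⌊M⌋₊ / n), ((μ (n * k₂) : ℝ) * ((psi (n * k₂))⁻¹ *
          P.eval (Real.log (M / ((n * k₂ : ℕ) : ℝ)) / Real.log M))) / ((n * k₂ : ℕ) : ℝ) * t₂ k₂) := by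
    rw [Finset.sum_mul_sum]
    exact Finset.sum_congr rfl fun k₁ _ ↦ Finset.sum_congr rfl fun k₂ _ ↦ by ring
  rw [hre, h1, h2]
  ring

/-! ### The master step -/

/-- **The product-monomial master step.** Let `t₁, t₂ : ℕ → ℝ` be decorations, `R₁, R₂` real polynomials, `s₁, s₂ : ℕ`, and
suppose the decorated profile coordinates satisfy, for `M ≥ 3`, `1 ≤ n ≤ M`,
`|Σ_c P_c(Σ_{k≤M/n} W(k)[(k,n)=1]t_i(k)logᶜ((M/n)/k))/logᶜM − E_n·R_i(log(M/n)/log M)/log^{s_i}M| ≤ C_i·D(n)(1+κ(n))/log^{s_i+1}M`.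
Then, with `y′(m) = μ(m)ψ(m)⁻¹P(log(M/m)/log M)/m`, there is `C` with, for all `M ≥ 3`,
`|Σ_{c≤⌊M⌋}Σ_{g≤⌊M⌋/c} μ(g)·c·Σ_{k₁,k₂≤⌊M⌋/(cg)} y′(cgk₁)y′(cgk₂)·t₁(k₁)t₂(k₂) − (π²/6)²·(∫₀¹R₁R₂)·log M/log^{s₁+s₂}M| ≤ C/log^{s₁+s₂}M`.
[cite: KowalskiMichelVanderKam2000, (23)–(28) and Prop. 5.1 — derivation (a monomial of the diagonal main term)] -/
theorem abs_selbergMonomial_sub_le (P : ℝ[X]) (t₁ t₂ : ℕ → ℝ) (R₁ R₂ : ℝ[X]) (s₁ s₂ : ℕ) {C₁ C₂ : ℝ}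
    (hC₁ : 0 ≤ C₁) (hC₂ : 0 ≤ C₂)
    (h₁ : ∀ M : ℝ, 3 ≤ M → ∀ n : ℕ, n ≠ 0 → (n : ℝ) ≤ M →
      |∑ c ∈ Finset.range (P.natDegree + 1), P.coeff c *
          ((∑ k ∈ Icc 1 ⌊M / n⌋₊, (if k.Coprime n then W k else 0) * t₁ k * Real.log (M / n / k) ^ c) /
            Real.log M ^ c) -
        mainConst n * R₁.eval (Real.log (M / n) / Real.log M) / Real.log M ^ s₁| ≤
        C₁ * divWeight n * (1 + kappa n) / Real.log M ^ (s₁ + 1))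
    (h₂ : ∀ M : ℝ, 3 ≤ M → ∀ n : ℕ, n ≠ 0 → (n : ℝ) ≤ M →
      |∑ c ∈ Finset.range (P.natDegree + 1), P.coeff c *
          ((∑ k ∈ Icc 1 ⌊M / n⌋₊, (if k.Coprime n then W k else 0) * t₂ k * Real.log (M / n / k) ^ c) /
            Real.log M ^ c) -
        mainConst n * R₂.eval (Real.log (M / n) / Real.log M) / Real.log M ^ s₂| ≤
        C₂ * divWeight n * (1 + kappa n) / Real.log M ^ (s₂ + 1)) :
    ∃ C : ℝ, 0 < C ∧ ∀ M : ℝ, 3 ≤ M →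
      |∑ c ∈ Icc 1 ⌊M⌋₊, ∑ g ∈ Icc 1 (⌊M⌋₊ / c), (μ g : ℝ) * c *
          ∑ k₁ ∈ Icc 1 (⌊M⌋₊ / (c * g)), ∑ k₂ ∈ Icc 1 (⌊M⌋₊ / (c * g)),
            ((μ (c * g * k₁) : ℝ) * ((psi (c * g * k₁))⁻¹ *
                P.eval (Real.log (M / ((c * g * k₁ : ℕ) : ℝ)) / Real.log M))) / ((c * g * k₁ : ℕ) : ℝ) *
              (((μ (c * g * k₂) : ℝ) * ((psi (c * g * k₂))⁻¹ *
                P.eval (Real.log (M / ((c * g * k₂ : ℕ) : ℝ)) / Real.log M))) / ((c * g * k₂ : ℕ) : ℝ)) *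
              (t₁ k₁ * t₂ k₂) -
        (π ^ 2 / 6) ^ 2 * (∫ u in (0 : ℝ)..1, (R₁ * R₂).eval u) * Real.log M / Real.log M ^ (s₁ + s₂)| ≤
        C / Real.log M ^ (s₁ + s₂) := by
  -- the decorated profile coordinates as functions of `(M, n)`
  set S₁ : ℝ → ℕ → ℝ := fun M n ↦ ∑ c ∈ Finset.range (P.natDegree + 1), P.coeff c *
    ((∑ k ∈ Icc 1 ⌊M / n⌋₊, (if k.Coprime n then W k else 0) * t₁ k * Real.log (M / n / k) ^ c) /
      Real.log M ^ c) with hS₁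
  set S₂ : ℝ → ℕ → ℝ := fun M n ↦ ∑ c ∈ Finset.range (P.natDegree + 1), P.coeff c *
    ((∑ k ∈ Icc 1 ⌊M / n⌋₊, (if k.Coprime n then W k else 0) * t₂ k * Real.log (M / n / k) ^ c) /
      Real.log M ^ c) with hS₂
  obtain ⟨C, hC, h⟩ := abs_bilinearHarmonic_sub_le R₁ R₂ s₁ s₂ S₁ S₂ hC₁ hC₂
    (fun M hM n hn hnM ↦ by simpa only [hS₁] using h₁ M hM n hn hnM)
    (fun M hM n hn hnM ↦ by simpa only [hS₂] using h₂ M hM n hn hnM)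
  refine ⟨C, hC, fun M hM ↦ ?_⟩
  -- factor the inner sums and collapse `(c,g) ↦ n = cg`
  have hinner : ∀ c ∈ Icc 1 ⌊M⌋₊, ∀ g ∈ Icc 1 (⌊M⌋₊ / c),
      (μ g : ℝ) * c * ∑ k₁ ∈ Icc 1 (⌊M⌋₊ / (c * g)), ∑ k₂ ∈ Icc 1 (⌊M⌋₊ / (c * g)),
        ((μ (c * g * k₁) : ℝ) * ((psi (c * g * k₁))⁻¹ *
            P.eval (Real.log (M / ((c * g * k₁ : ℕ) : ℝ)) / Real.log M))) / ((c * g * k₁ : ℕ) : ℝ) *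
          (((μ (c * g * k₂) : ℝ) * ((psi (c * g * k₂))⁻¹ *
            P.eval (Real.log (M / ((c * g * k₂ : ℕ) : ℝ)) / Real.log M))) / ((c * g * k₂ : ℕ) : ℝ)) *
          (t₁ k₁ * t₂ k₂) =
      (μ g : ℝ) * c * (W (c * g) ^ 2 * (S₁ M (c * g) * S₂ M (c * g))) := by
    intro c hc g hg
    have hc0 : c ≠ 0 := by have := (Finset.mem_Icc.1 hc).1; omega
    have hg0 : g ≠ 0 := by have := (Finset.mem_Icc.1 hg).1; omega
    have hcg : c * g ≠ 0 := mul_ne_zero hc0 hg0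
    rw [selbergInner_eq_W_sq_mul P M hcg t₁ t₂]
  rw [Finset.sum_congr rfl fun c hc ↦ Finset.sum_congr rfl fun g hg ↦ hinner c hc g hg,
    selbergCollapse_zero ⌊M⌋₊ (fun n ↦ W n ^ 2 * (S₁ M n * S₂ M n))]
  have hre : ∑ n ∈ Icc 1 ⌊M⌋₊, (Nat.totient n : ℝ) * (W n ^ 2 * (S₁ M n * S₂ M n)) =
      ∑ n ∈ Icc 1 ⌊M⌋₊, (Nat.totient n : ℝ) * W n ^ 2 * (S₁ M n * S₂ M n) :=
    Finset.sum_congr rfl fun n _ ↦ by ring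
  rw [hre]
  exact h M hM

end Summit.Parity.GeneralizedHardyLittlewood.Theorems.MomentsBeyondDiagonal.DiagKernel

end
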